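import Literature.Analysis.SpecialFunctions.GegenbauerExplicitODE
import Literature.Analysis.SpecialFunctions.JacobiHeatPositivity
import Mathlib.Analysis.Calculus.ParametricIntervalIntegral
import Mathlib.Analysis.Calculus.Deriv.MeanValue
import Mathlib.MeasureTheory.Integral.IntervalIntegral.FundThmCalculus
import HarnessLib

/-!
# Positivity preservation for the ultraspherical heat flow on polynomials

For `k ∈ ℕ`, `a = k + 1/2` (the zonal parameter of the even-dimensional sphere `S^{2k+2}`:
`k = 0, 1, 2` for `S², S⁴, S⁶`), finitely many coefficients `b_0, …, b_{J-1}` and the explicit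
Gegenbauer sums `C_j^{(a)}` of `GegenbauerExplicitODE.lean`, the polynomial heat flow

  `V(s, τ) = Σ_{j<J} b_j e^{-j(j+2k+1)τ} C_j^{(a)}(s)`,  `∂_τ V = (1-s²) ∂²_s V - (2k+2) s ∂_s V`
  (`= (1-s²)^{-k} ∂_s[(1-s²)^{k+1} ∂_s V]`, the radial part of the Laplacian of `S^{2k+2}` in
  `s = cos(distance)`, term-wise the ultraspherical equation `gegenbauerSum_ode`),

preserves non-negativity on `[-1, 1]`: **if `V(·, 0) ≥ 0` on `[-1,1]` then `V(·, τ) ≥ 0` on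
`[-1,1]` for every `τ ≥ 0`** (`gegenbauerHeat_nonneg`).  The proof is the energy argument of
`JacobiHeatPositivity.lean` (whose convex test function `Φ = min(·,0)⁴`, `negPartPow4`, is reused)
with the polynomial weight `ρ = (1-s²)^k` and flux coefficient `P = (1-s²)^{k+1}`, which vanishes
at both ends: `E(τ) = ∫_{-1}^{1} ρ Φ(V)`, `E' = ∫ ρ Φ'(V) ∂_τ V = ∫ Φ'(V) ∂_s(P ∂_s V)
= -∫ P Φ''(V) (∂_s V)² ≤ 0`, `E ≥ 0`, `E(0) = 0`, hence `E ≡ 0` on `τ ≥ 0` and `V ≥ 0`.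

This is the finite-dimensional (polynomial) core of the positivity of the heat kernel of
`S^{2k+2}`; the passage to the kernel series (duality against orthogonality of the `C_j^{(a)}` and
polynomial approximation) is NOT done here.  Everything is proved; no named facts.

## References
* E. B. Davies, *Heat Kernels and Spectral Theory*, CUP 1989, Ch. 5 (positivity of heat
  semigroups).
* G. E. Andrews, R. Askey, R. Roy, *Special Functions*, CUP 1999, §6.4 ((6.4.19')).
-/

noncomputable section

open Set MeasureTheory intervalIntegral Filter
open scoped Topology Interval BigOperators

namespace Literature.Analysis.SpecialFunctions

/-! ### The polynomial heat flow and its derivatives -/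

/-- **The ultraspherical polynomial heat flow**
`V(s, τ) = Σ_{j<J} b_j e^{-j(j+2k+1)τ} C_j^{(k+1/2)}(s)`. [folklore] -/
def gegenbauerHeat (k : ℕ) (b : ℕ → ℝ) (J : ℕ) (s τ : ℝ) : ℝ :=
  ∑ j ∈ Finset.range J, b j * Real.exp (-((j : ℝ) * ((j : ℝ) + 2 * k + 1) * τ)) *
    gegenbauerSum ((k : ℝ) + 1 / 2) j s

/-- `∂_s V`. [folklore] -/
def gegenbauerHeatDs (k : ℕ) (b : ℕ → ℝ) (J : ℕ) (s τ : ℝ) : ℝ :=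
  ∑ j ∈ Finset.range J, b j * Real.exp (-((j : ℝ) * ((j : ℝ) + 2 * k + 1) * τ)) *
    gegenbauerSumD ((k : ℝ) + 1 / 2) j s

/-- `∂²_s V`. [folklore] -/
def gegenbauerHeatDss (k : ℕ) (b : ℕ → ℝ) (J : ℕ) (s τ : ℝ) : ℝ :=
  ∑ j ∈ Finset.range J, b j * Real.exp (-((j : ℝ) * ((j : ℝ) + 2 * k + 1) * τ)) *
    gegenbauerSumDD ((k : ℝ) + 1 / 2) j s

/-- `∂_τ V`. [folklore] -/
def gegenbauerHeatDt (k : ℕ) (b : ℕ → ℝ) (J : ℕ) (s τ : ℝ) : ℝ :=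
  ∑ j ∈ Finset.range J, -((j : ℝ) * ((j : ℝ) + 2 * k + 1)) *
    (b j * Real.exp (-((j : ℝ) * ((j : ℝ) + 2 * k + 1) * τ)) * gegenbauerSum ((k : ℝ) + 1 / 2) j s)

section Flow

variable (k : ℕ) (b : ℕ → ℝ) (J : ℕ)

/-- `∂_s V` is the `s`-derivative. [folklore] -/
theorem hasDerivAt_gegenbauerHeat_s (s τ : ℝ) :
    HasDerivAt (fun x => gegenbauerHeat k b J x τ) (gegenbauerHeatDs k b J s τ) s := by
  unfold gegenbauerHeat gegenbauerHeatDs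
  refine HasDerivAt.fun_sum fun j _ => ?_
  exact (hasDerivAt_gegenbauerSum _ j s).const_mul _

/-- `∂²_s V` is the `s`-derivative of `∂_s V`. [folklore] -/
theorem hasDerivAt_gegenbauerHeatDs_s (s τ : ℝ) :
    HasDerivAt (fun x => gegenbauerHeatDs k b J x τ) (gegenbauerHeatDss k b J s τ) s := by
  unfold gegenbauerHeatDs gegenbauerHeatDss
  refine HasDerivAt.fun_sum fun j _ => ?_
  exact (hasDerivAt_gegenbauerSumD _ j s).const_mul _

/-- `∂_τ V` is the `τ`-derivative. [folklore] -/
theorem hasDerivAt_gegenbauerHeat_t (s τ : ℝ) :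
    HasDerivAt (fun t => gegenbauerHeat k b J s t) (gegenbauerHeatDt k b J s τ) τ := by
  unfold gegenbauerHeat gegenbauerHeatDt
  refine HasDerivAt.fun_sum fun j _ => ?_
  have h1 : HasDerivAt (fun t : ℝ => -((j : ℝ) * ((j : ℝ) + 2 * k + 1) * t))
      (-((j : ℝ) * ((j : ℝ) + 2 * k + 1))) τ :=
    (((hasDerivAt_id τ).const_mul ((j : ℝ) * ((j : ℝ) + 2 * k + 1))).neg).congr_deriv (by simp)
  exact ((h1.exp.const_mul (b j)).mul_const (gegenbauerSum ((k : ℝ) + 1 / 2) j s)).congr_deriv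
    (by ring)

/-- **The heat equation** `∂_τ V = (1-s²) ∂²_s V - (2k+2) s ∂_s V` at every real `s`
(term-wise the ultraspherical equation with `a = k + 1/2`). [folklore] -/
theorem gegenbauerHeat_pde (s τ : ℝ) :
    gegenbauerHeatDt k b J s τ =
      (1 - s ^ 2) * gegenbauerHeatDss k b J s τ - (2 * k + 2) * s * gegenbauerHeatDs k b J s τ := by
  unfold gegenbauerHeatDt gegenbauerHeatDss gegenbauerHeatDs
  rw [Finset.mul_sum, Finset.mul_sum, ← Finset.sum_sub_distrib]
  refine Finset.sum_congr rfl fun j _ => ?_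
  have hode := gegenbauerSum_ode ((k : ℝ) + 1 / 2) j s
  linear_combination (-(b j * Real.exp (-((j : ℝ) * ((j : ℝ) + 2 * k + 1) * τ)))) * hode

/-- `V` is jointly continuous. [folklore] -/
theorem continuous_gegenbauerHeat :
    Continuous fun p : ℝ × ℝ => gegenbauerHeat k b J p.1 p.2 := by
  unfold gegenbauerHeat
  refine continuous_finsetSum _ fun j _ => ?_
  exact (continuous_const.mul (Real.continuous_exp.comp (by fun_prop))).mul
    ((continuous_gegenbauerSum _ j).comp continuous_fst)

/-- `∂_s V` is jointly continuous. [folklore] -/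
theorem continuous_gegenbauerHeatDs :
    Continuous fun p : ℝ × ℝ => gegenbauerHeatDs k b J p.1 p.2 := by
  unfold gegenbauerHeatDs
  refine continuous_finsetSum _ fun j _ => ?_
  exact (continuous_const.mul (Real.continuous_exp.comp (by fun_prop))).mul
    ((continuous_gegenbauerSumD _ j).comp continuous_fst)

/-- `∂²_s V` is jointly continuous. [folklore] -/
theorem continuous_gegenbauerHeatDss :
    Continuous fun p : ℝ × ℝ => gegenbauerHeatDss k b J p.1 p.2 := by
  unfold gegenbauerHeatDss
  refine continuous_finsetSum _ fun j _ => ?_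
  exact (continuous_const.mul (Real.continuous_exp.comp (by fun_prop))).mul
    ((continuous_gegenbauerSumDD _ j).comp continuous_fst)

/-- `∂_τ V` is jointly continuous. [folklore] -/
theorem continuous_gegenbauerHeatDt :
    Continuous fun p : ℝ × ℝ => gegenbauerHeatDt k b J p.1 p.2 := by
  unfold gegenbauerHeatDt
  refine continuous_finsetSum _ fun j _ => ?_
  exact continuous_const.mul ((continuous_const.mul (Real.continuous_exp.comp (by fun_prop))).mul
    ((continuous_gegenbauerSum _ j).comp continuous_fst))

/-- A continuous function on `ℝ × ℝ` is bounded on `[-1, 1] × [T₀, T₁]`. [folklore] -/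
theorem exists_bound_on_box_symm {F : ℝ × ℝ → ℝ} (hF : Continuous F) (T₀ T₁ : ℝ) :
    ∃ M : ℝ, ∀ s ∈ Icc (-1 : ℝ) 1, ∀ t ∈ Icc T₀ T₁, |F (s, t)| ≤ M := by
  obtain ⟨M, hM⟩ := (isCompact_Icc.prod isCompact_Icc).exists_bound_of_continuousOn
    (s := Icc (-1 : ℝ) 1 ×ˢ Icc T₀ T₁) hF.continuousOn
  exact ⟨M, fun s hs t ht => by simpa [Real.norm_eq_abs] using hM (s, t) ⟨hs, ht⟩⟩

/-! ### The weight `ρ = (1-s²)^k` and the flux coefficient `P = (1-s²)^{k+1}` -/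

/-- `ρ ≥ 0` on `[-1, 1]`. [folklore] -/
theorem ultrasphericalWeight_nonneg {s : ℝ} (hs : s ∈ Icc (-1 : ℝ) 1) : 0 ≤ (1 - s ^ 2) ^ k := by
  have : 0 ≤ 1 - s ^ 2 := by nlinarith [hs.1, hs.2]
  positivity

/-- `ρ > 0` on `(-1, 1)`. [folklore] -/
theorem ultrasphericalWeight_pos {s : ℝ} (hs : s ∈ Ioo (-1 : ℝ) 1) : 0 < (1 - s ^ 2) ^ k := by
  have : 0 < 1 - s ^ 2 := by nlinarith [hs.1, hs.2]
  positivity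

/-- `P' = -(2k+2) s ρ`. [folklore] -/
theorem hasDerivAt_ultrasphericalFlux (s : ℝ) :
    HasDerivAt (fun x : ℝ => (1 - x ^ 2) ^ (k + 1)) (-(2 * (k : ℝ) + 2) * s * (1 - s ^ 2) ^ k) s := by
  have h1 : HasDerivAt (fun x : ℝ => 1 - x ^ 2) (-(2 * s)) s := by
    simpa using (hasDerivAt_pow 2 s).const_sub 1
  refine (h1.pow (k + 1)).congr_deriv ?_
  rw [Nat.add_sub_cancel]
  push_cast
  ring

/-! ### Positivity preservation by the energy method -/

/-- The energy `E(τ) = ∫_{-1}^{1} ρ Φ(V(s, τ)) ds`. [folklore] -/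
def gegenbauerHeatEnergy (k : ℕ) (b : ℕ → ℝ) (J : ℕ) (τ : ℝ) : ℝ :=
  ∫ s in (-1 : ℝ)..1, (1 - s ^ 2) ^ k * negPartPow4 (gegenbauerHeat k b J s τ)

/-- **`E'(τ) = ∫ ρ Φ'(V) ∂_τ V`** (differentiation under the integral sign: the integrand and its
`τ`-derivative are continuous, hence bounded on `[-1,1] × [τ-1, τ+1]`). [folklore] -/
theorem hasDerivAt_gegenbauerHeatEnergy (τ : ℝ) :
    HasDerivAt (gegenbauerHeatEnergy k b J)
      (∫ s in (-1 : ℝ)..1, (1 - s ^ 2) ^ k *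
        (negPartPow4D (gegenbauerHeat k b J s τ) * gegenbauerHeatDt k b J s τ)) τ := by
  have hcontG : Continuous fun p : ℝ × ℝ =>
      (1 - p.1 ^ 2) ^ k * (negPartPow4D (gegenbauerHeat k b J p.1 p.2) * gegenbauerHeatDt k b J p.1 p.2) :=
    (by fun_prop : Continuous fun p : ℝ × ℝ => (1 - p.1 ^ 2) ^ k).mul
      ((continuous_negPartPow4D.comp (continuous_gegenbauerHeat k b J)).mul
        (continuous_gegenbauerHeatDt k b J))
  have hcontF : Continuous fun p : ℝ × ℝ =>
      (1 - p.1 ^ 2) ^ k * negPartPow4 (gegenbauerHeat k b J p.1 p.2) :=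
    (by fun_prop : Continuous fun p : ℝ × ℝ => (1 - p.1 ^ 2) ^ k).mul
      (continuous_negPartPow4.comp (continuous_gegenbauerHeat k b J))
  obtain ⟨M, hM⟩ := exists_bound_on_box_symm hcontG (τ - 1) (τ + 1)
  have hIoc : Ι (-1 : ℝ) 1 = Set.Ioc (-1) 1 := Set.uIoc_of_le (by norm_num)
  have key := intervalIntegral.hasDerivAt_integral_of_dominated_loc_of_deriv_le
    (μ := volume) (a := (-1 : ℝ)) (b := 1) (x₀ := τ) (s := Icc (τ - 1) (τ + 1))
    (F := fun t s => (1 - s ^ 2) ^ k * negPartPow4 (gegenbauerHeat k b J s t))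
    (F' := fun t s => (1 - s ^ 2) ^ k *
      (negPartPow4D (gegenbauerHeat k b J s t) * gegenbauerHeatDt k b J s t))
    (bound := fun _ => M)
    (Icc_mem_nhds (by linarith) (by linarith))
    (Eventually.of_forall fun t =>
      (hcontF.comp (Continuous.prodMk_left t)).aestronglyMeasurable)
    ((hcontF.comp (Continuous.prodMk_left τ)).intervalIntegrable _ _)
    (hcontG.comp (Continuous.prodMk_left τ)).aestronglyMeasurable
    (ae_of_all _ fun s hs t ht => by
      rw [hIoc] at hs
      simpa [Real.norm_eq_abs] using hM s ⟨hs.1.le, hs.2⟩ t ht)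
    intervalIntegrable_const
    (ae_of_all _ fun s _ t _ => by
      have h := (hasDerivAt_negPartPow4 _).comp t (hasDerivAt_gegenbauerHeat_t k b J s t)
      exact h.const_mul _)
  exact key.2

/-- **The energy dissipation identity**: `E'(τ) = -∫ P Φ''(V) (∂_s V)²` — from
`ρ ∂_τ V = (P ∂_s V)'` and the fundamental theorem of calculus for `Φ'(V) P ∂_s V`, which vanishes
at `s = ±1`. [folklore] -/
theorem deriv_gegenbauerHeatEnergy_eq (τ : ℝ) :
    ∫ s in (-1 : ℝ)..1, (1 - s ^ 2) ^ k *
        (negPartPow4D (gegenbauerHeat k b J s τ) * gegenbauerHeatDt k b J s τ)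
      = -∫ s in (-1 : ℝ)..1, (1 - s ^ 2) ^ (k + 1) *
          (negPartPow4DD (gegenbauerHeat k b J s τ) * (gegenbauerHeatDs k b J s τ) ^ 2) := by
  set V : ℝ → ℝ := fun s => gegenbauerHeat k b J s τ with hV
  set Vs : ℝ → ℝ := fun s => gegenbauerHeatDs k b J s τ with hVs
  set Vss : ℝ → ℝ := fun s => gegenbauerHeatDss k b J s τ with hVss
  set Vt : ℝ → ℝ := fun s => gegenbauerHeatDt k b J s τ with hVt
  have hVc : Continuous V := (continuous_gegenbauerHeat k b J).comp (Continuous.prodMk_left τ)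
  have hVsc : Continuous Vs := (continuous_gegenbauerHeatDs k b J).comp (Continuous.prodMk_left τ)
  have hVssc : Continuous Vss :=
    (continuous_gegenbauerHeatDss k b J).comp (Continuous.prodMk_left τ)
  -- `H = Φ'(V) P Vs`, zero at the ends
  set H : ℝ → ℝ := fun s => negPartPow4D (V s) * ((1 - s ^ 2) ^ (k + 1) * Vs s) with hH
  set f₁ : ℝ → ℝ := fun s => negPartPow4DD (V s) * Vs s * ((1 - s ^ 2) ^ (k + 1) * Vs s) with hf₁
  set f₂ : ℝ → ℝ := fun s => negPartPow4D (V s) *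
    ((1 - s ^ 2) ^ k * ((1 - s ^ 2) * Vss s - (2 * k + 2) * s * Vs s)) with hf₂
  have hderiv : ∀ s ∈ Ioo (-1 : ℝ) 1, HasDerivAt H (f₁ s + f₂ s) s := by
    intro s _
    have h1 : HasDerivAt (fun s => negPartPow4D (V s)) (negPartPow4DD (V s) * Vs s) s :=
      (hasDerivAt_negPartPow4D _).comp s (hasDerivAt_gegenbauerHeat_s k b J s τ)
    have h2 : HasDerivAt (fun s => (1 - s ^ 2) ^ (k + 1) * Vs s)
        (-(2 * (k : ℝ) + 2) * s * (1 - s ^ 2) ^ k * Vs s + (1 - s ^ 2) ^ (k + 1) * Vss s) s :=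
      (hasDerivAt_ultrasphericalFlux k s).mul (hasDerivAt_gegenbauerHeatDs_s k b J s τ)
    refine (h1.mul h2).congr_deriv ?_
    simp only [hf₁, hf₂]
    ring
  have hi₁ : IntervalIntegrable f₁ volume (-1) 1 :=
    ((((continuous_negPartPow4DD.comp hVc).mul hVsc).mul ((by fun_prop : Continuous
      fun s : ℝ => (1 - s ^ 2) ^ (k + 1)).mul hVsc)).intervalIntegrable _ _)
  have hi₂ : IntervalIntegrable f₂ volume (-1) 1 :=
    (((continuous_negPartPow4D.comp hVc)).mul ((by fun_prop : Continuous
      fun s : ℝ => (1 - s ^ 2) ^ k).mul (by fun_prop))).intervalIntegrable _ _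
  have hcont : ContinuousOn H (Icc (-1) 1) :=
    ((continuous_negPartPow4D.comp hVc).mul ((by fun_prop : Continuous
      fun s : ℝ => (1 - s ^ 2) ^ (k + 1)).mul hVsc)).continuousOn
  have hftc := intervalIntegral.integral_eq_sub_of_hasDerivAt_of_le (by norm_num : (-1 : ℝ) ≤ 1)
    hcont hderiv (hi₁.add hi₂)
  have hH1 : H 1 = 0 := by simp [hH]
  have hH2 : H (-1) = 0 := by simp [hH]
  rw [hH1, hH2, sub_self, intervalIntegral.integral_add hi₁ hi₂] at hftc
  -- `ρ Φ'(V) Vt = f₂`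
  have hlhs : ∫ s in (-1 : ℝ)..1, (1 - s ^ 2) ^ k * (negPartPow4D (V s) * Vt s)
      = ∫ s in (-1 : ℝ)..1, f₂ s := by
    refine intervalIntegral.integral_congr fun s _ => ?_
    simp only [hf₂, hVt, hVss, hVs, gegenbauerHeat_pde k b J s τ]
    ring
  have hrhs : ∫ s in (-1 : ℝ)..1, (1 - s ^ 2) ^ (k + 1) * (negPartPow4DD (V s) * (Vs s) ^ 2)
      = ∫ s in (-1 : ℝ)..1, f₁ s :=
    intervalIntegral.integral_congr fun s _ => by simp only [hf₁]; ring
  rw [hlhs, hrhs]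
  linear_combination hftc

/-- **`E` is non-increasing** (`E' = -∫ P Φ''(V) (∂_s V)² ≤ 0`). [folklore] -/
theorem antitone_gegenbauerHeatEnergy : Antitone (gegenbauerHeatEnergy k b J) := by
  refine antitone_of_deriv_nonpos
    (fun τ => (hasDerivAt_gegenbauerHeatEnergy k b J τ).differentiableAt) fun τ => ?_
  rw [(hasDerivAt_gegenbauerHeatEnergy k b J τ).deriv, deriv_gegenbauerHeatEnergy_eq k b J τ]
  have : 0 ≤ ∫ s in (-1 : ℝ)..1, (1 - s ^ 2) ^ (k + 1) *
      (negPartPow4DD (gegenbauerHeat k b J s τ) * (gegenbauerHeatDs k b J s τ) ^ 2) :=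
    intervalIntegral.integral_nonneg (by norm_num) fun s hs =>
      mul_nonneg (ultrasphericalWeight_nonneg (k + 1) hs) (mul_nonneg (negPartPow4DD_nonneg _) (sq_nonneg _))
  linarith

/-- `E ≥ 0`. [folklore] -/
theorem gegenbauerHeatEnergy_nonneg (τ : ℝ) : 0 ≤ gegenbauerHeatEnergy k b J τ :=
  intervalIntegral.integral_nonneg (by norm_num) fun _ hs =>
    mul_nonneg (ultrasphericalWeight_nonneg k hs) (negPartPow4_nonneg _)

/-- `E(0) = 0` if `V(·, 0) ≥ 0` on `[-1, 1]`. [folklore] -/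
theorem gegenbauerHeatEnergy_zero (h0 : ∀ s ∈ Icc (-1 : ℝ) 1, 0 ≤ gegenbauerHeat k b J s 0) :
    gegenbauerHeatEnergy k b J 0 = 0 := by
  unfold gegenbauerHeatEnergy
  rw [intervalIntegral.integral_congr (g := fun _ => (0 : ℝ)) fun s hs => ?_]
  · simp
  · rw [Set.uIcc_of_le (by norm_num : (-1 : ℝ) ≤ 1)] at hs
    simp only [negPartPow4_of_nonneg (h0 s hs), mul_zero]

/-- **Positivity preservation for the ultraspherical polynomial heat flow**: if `V(·, 0) ≥ 0` on
`[-1, 1]` then `V(s, τ) ≥ 0` for all `τ ≥ 0`, `s ∈ [-1, 1]`. [folklore] -/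
theorem gegenbauerHeat_nonneg (h0 : ∀ s ∈ Icc (-1 : ℝ) 1, 0 ≤ gegenbauerHeat k b J s 0)
    {τ : ℝ} (hτ : 0 ≤ τ) {s : ℝ} (hs : s ∈ Icc (-1 : ℝ) 1) : 0 ≤ gegenbauerHeat k b J s τ := by
  -- `E(τ) = 0`
  have hE : gegenbauerHeatEnergy k b J τ = 0 :=
    le_antisymm ((antitone_gegenbauerHeatEnergy k b J hτ).trans_eq
      (gegenbauerHeatEnergy_zero k b J h0)) (gegenbauerHeatEnergy_nonneg k b J τ)
  have hVc : Continuous fun x => gegenbauerHeat k b J x τ :=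
    (continuous_gegenbauerHeat k b J).comp (Continuous.prodMk_left τ)
  -- first on the open interval, by contradiction
  have hopen : ∀ y ∈ Ioo (-1 : ℝ) 1, 0 ≤ gegenbauerHeat k b J y τ := by
    intro y hy
    by_contra hneg
    push Not at hneg
    have hev : ∀ᶠ x in 𝓝 y, gegenbauerHeat k b J x τ < 0 :=
      hVc.continuousAt.eventually (gt_mem_nhds hneg)
    obtain ⟨ε, hε, hball⟩ := Metric.eventually_nhds_iff.1 hev
    set δ := min ε (min ((y + 1) / 2) ((1 - y) / 2)) with hδ
    have hδ0 : 0 < δ := lt_min hε (lt_min (by linarith [hy.1]) (by linarith [hy.2]))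
    have hδε : δ ≤ ε := min_le_left _ _
    have hδy : δ ≤ (y + 1) / 2 := (min_le_right _ _).trans (min_le_left _ _)
    have hδy' : δ ≤ (1 - y) / 2 := (min_le_right _ _).trans (min_le_right _ _)
    set f : ℝ → ℝ := fun x => (1 - x ^ 2) ^ k * negPartPow4 (gegenbauerHeat k b J x τ) with hf
    have hfc : Continuous f := (by fun_prop : Continuous fun x : ℝ => (1 - x ^ 2) ^ k).mul
      (continuous_negPartPow4.comp hVc)
    have hfnn : ∀ x ∈ Icc (-1 : ℝ) 1, 0 ≤ f x := fun x hx =>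
      mul_nonneg (ultrasphericalWeight_nonneg k hx) (negPartPow4_nonneg _)
    have hpos : 0 < ∫ x in (y - δ)..(y + δ), f x := by
      refine intervalIntegral.intervalIntegral_pos_of_pos_on (hfc.intervalIntegrable _ _)
        (fun x hx => ?_) (by linarith)
      have hx01 : x ∈ Ioo (-1 : ℝ) 1 := ⟨by linarith [hx.1], by linarith [hx.2]⟩
      have hVneg : gegenbauerHeat k b J x τ < 0 := hball (by
        rw [Real.dist_eq, abs_lt]; constructor <;> linarith [hx.1, hx.2])
      exact mul_pos (ultrasphericalWeight_pos k hx01) (negPartPow4_pos hVneg)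
    have hle : ∫ x in (y - δ)..(y + δ), f x ≤ ∫ x in (-1 : ℝ)..1, f x :=
      intervalIntegral.integral_mono_interval (by linarith) (by linarith) (by linarith)
        ((ae_restrict_mem measurableSet_Ioc).mono fun x hx => hfnn x ⟨hx.1.le, hx.2⟩)
        (hfc.intervalIntegrable _ _)
    have : (0 : ℝ) < gegenbauerHeatEnergy k b J τ := hpos.trans_le hle
    linarith
  -- endpoints by continuity
  have hclosed : IsClosed {y : ℝ | 0 ≤ gegenbauerHeat k b J y τ} := isClosed_le continuous_const hVc
  have := hclosed.closure_subset_iff.2 (show Ioo (-1 : ℝ) 1 ⊆ _ from hopen)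
  rw [closure_Ioo (by norm_num : (-1 : ℝ) ≠ 1)] at this
  exact this hs

end Flow

end Literature.Analysis.SpecialFunctions
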